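import Summits.PneNP.PneNP.Theorems.ExpanderLinearGeneratorsThreeLassos
import Summits.PneNP.PneNP.Theorems.ExpanderLinearGeneratorsLinearGeneratorDepthFregeHardLocalityFloor

/-!
# The locality floor `ℓ ≤ 8` of `LinearGeneratorDepthFregeHard` (route ExpanderLinearGenerators)

Third helper file for the `ℓ = 8` locality floor of item stmt-PneNP-11443
(`Summit.PneNP.PneNP.Theses.ExpanderLinearGenerators.LinearGeneratorDepthFregeHard`, Krajíček's
Problem 19.4.5 in universal-expander form), on top of `…SteeredWalks.lean`, `…ThreeLassos.lean`
(the combinatorial core) and `…LocalityFloor.lean` / `…DepthFloor.lean` (the corners `ℓ ≤ 7`,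
`d ≤ 6`).

* `sum_coverDegree_two_le_of_isBoundaryExpander` — for scopes of size `≤ ℓ` forming an
  `(r, 3/4·ℓ)`-boundary expander and `|F| ≤ r`, the points of `F`-degree `≥ 2` absorb at most
  `(ℓ/4)|F|` incidences (`= ∑_i |S i| - |∂F|`).
* `boundary_nonempty_of_isBoundaryExpander_of_le_eight` — hence, for `1 ≤ ℓ ≤ 8`,
  `|cover J| < 2^t` and `r ≥ 6t + 1`, every nonempty `J` has a boundary point: a boundaryless `J`
  would contain an over-shared `F` with `|F| ≤ 6t + 1` (`exists_overShared_of_boundary_eq_empty`,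
  three lassos) and `2|F| + 1 ≤ (ℓ/4)|F| ≤ 2|F|` is absurd (`ℓ ≤ 3`: a scope and a partner scope
  already violate expansion).
* `systemSat_of_isBoundaryExpander_of_le_eight` — an `ℓ`-sparse system over `𝔽₂` in `n < 2^t`
  variables, `ℓ ≤ 8`, whose supports form an `(r, 3/4·ℓ)`-boundary expander with `r ≥ 6t + 1` is
  solvable (peeling).
* `exists_nat_log_threshold` — `6(⌊log₂ n⌋ + 1) + 1 ≤ n^{1-δ}` eventually.
* `linearGeneratorDepthFregeHard_locality_le_eight` — the `ℓ ≤ 8` slice of the item (vacuous),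
  and `linearGeneratorDepthFregeHard_iff_nine_le_and_seven_le` — the item is equivalent to its
  restriction to `ℓ ≥ 9`, `d ≥ 7`.

Why `ℓ = 8` is special to this item: at unique-neighbour expansion `3/4 · ℓ ≤ 6` with scopes of
`≤ 8` points a boundaryless expanding family needs `|cover J| ≥ 2^{(r-1)/6}` points (three
lassos), and the item ties `r = n^{1-δ}` to the number `n ≥ |cover J|` of variables polynomially,
so no such family exists for large `n` — whereas the sibling rung `ExpansionForcesDepthFregeSize`,
uniform in `n`, has genuine `ℓ = 8` instances (incidence structures of girth `> 2r`, e.g. Tseitin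
systems of `8`-regular graphs of large girth, on `2^{Ω(r)}` points). From `ℓ = 9` on, Tseitin
systems of random `9`-regular graphs satisfy the hypotheses in the item's regime (informally), and
the item is Krajíček's open problem proper.

References: J. Krajíček, *Proof Complexity* (CUP 2019), §13.3 and Problem 19.4.5
[KrajicekProofComplexity2019]; E. Ben-Sasson, A. Wigderson, J. ACM 48 (2001) §5
[BenSassonWigderson2001]; the combinatorics is folklore (Moore bound).
-/

namespace Summit.PneNP.PneNP.Theorems

set_option linter.dupNamespace false -- `Summit.PneNP.PneNP.…`: summit = sub-problem (D-0017)

open Finset Literature.Computability.MetaComplexity Literature.Computability.Complexity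
open Literature.Computability.Complexity.PropForm

/-! ### Expansion forbids over-shared subfamilies at locality `ℓ ≤ 8` -/

section Scopes

variable {ι : Type*} [DecidableEq ι] {S : ι → Finset ℕ} {J : Finset ι}

/-- **Unique-neighbour expansion bounds the shared incidences.** If the scopes have `≤ ℓ` points
and form an `(r, 3/4 · ℓ)`-boundary expander, then for `|F| ≤ r` the points of `F`-degree `≥ 2`
absorb at most `(ℓ/4) |F|` incidences: `∑_{w : deg_F w ≥ 2} deg_F w = ∑_i |S i| - |∂F|`.
[folklore] -/
theorem sum_coverDegree_two_le_of_isBoundaryExpander {ℓ : ℕ} (hS : ∀ i, (S i).card ≤ ℓ)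
    {r : ℝ} (hexp : IsBoundaryExpander S r (3 / 4 * ℓ)) {F : Finset ι} (hF : (F.card : ℝ) ≤ r) :
    ((∑ w ∈ (cover S F).filter (fun w => 2 ≤ coverDegree S F w), coverDegree S F w : ℕ) : ℝ) ≤
      (ℓ : ℝ) / 4 * F.card := by
  classical
  have hsplit := Finset.sum_filter_add_sum_filter_not (cover S F) (fun w => 2 ≤ coverDegree S F w)
    (fun w => coverDegree S F w)
  have hnot : ∑ w ∈ (cover S F).filter (fun w => ¬ 2 ≤ coverDegree S F w), coverDegree S F w =
      (boundary S F).card := by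
    have hfilt : (cover S F).filter (fun w => ¬ 2 ≤ coverDegree S F w) = boundary S F := by
      unfold boundary
      refine Finset.filter_congr fun w hw => ?_
      have := one_le_coverDegree hw
      omega
    rw [hfilt, Finset.card_eq_sum_ones]
    refine Finset.sum_congr rfl fun w hw => (mem_boundary.1 hw).2
  have htot : ∑ w ∈ cover S F, coverDegree S F w ≤ ℓ * F.card := by
    rw [sum_coverDegree]
    calc ∑ i ∈ F, (S i).card ≤ ∑ _i ∈ F, ℓ := Finset.sum_le_sum fun i _ => hS i
      _ = ℓ * F.card := by rw [Finset.sum_const, smul_eq_mul, mul_comm]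
  have hbd := hexp F hF
  have hnat : ∑ w ∈ (cover S F).filter (fun w => 2 ≤ coverDegree S F w), coverDegree S F w +
      (boundary S F).card ≤ ℓ * F.card := by
    rw [← hnot, hsplit]; exact htot
  have hreal : ((∑ w ∈ (cover S F).filter (fun w => 2 ≤ coverDegree S F w),
      coverDegree S F w : ℕ) : ℝ) + (boundary S F).card ≤ ℓ * F.card := by exact_mod_cast hnat
  linarith

/-- **No boundaryless subfamilies at locality `ℓ ≤ 8` (logarithmic radius).** If every scope has
at most `ℓ` points, `1 ≤ ℓ ≤ 8`, the scopes form an `(r, 3/4 · ℓ)`-boundary expander,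
`|cover J| < 2^t` and `r ≥ 6 t + 1`, then every nonempty `J` has a boundary point. For `ℓ ≤ 3` a
scope and a partner scope through one of its points already violate expansion; for `4 ≤ ℓ ≤ 8`
the scopes of a boundaryless `J` have `≥ 3` points, `exists_overShared_of_boundary_eq_empty`
gives an over-shared `F` with `|F| ≤ 6 t + 1 ≤ r`, and
`sum_coverDegree_two_le_of_isBoundaryExpander` gives `2|F| + 1 ≤ (ℓ/4)|F| ≤ 2|F|`. [folklore] -/
theorem boundary_nonempty_of_isBoundaryExpander_of_le_eight {ℓ : ℕ} (hℓ1 : 1 ≤ ℓ) (hℓ8 : ℓ ≤ 8)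
    (hS : ∀ i, (S i).card ≤ ℓ) {r : ℝ} {t : ℕ} (ht : (cover S J).card < 2 ^ t)
    (hr : (6 * t + 1 : ℝ) ≤ r) (hexp : IsBoundaryExpander S r (3 / 4 * ℓ)) (hJ : J.Nonempty) :
    (boundary S J).Nonempty := by
  classical
  by_contra hcon
  have hbd : boundary S J = ∅ := Finset.not_nonempty_iff_eq_empty.1 hcon
  have hc : (0 : ℝ) < 3 / 4 * ℓ := by
    have : (1 : ℝ) ≤ ℓ := by exact_mod_cast hℓ1
    linarith
  have hr1 : (1 : ℝ) ≤ r := le_trans (by have h0 : (0 : ℝ) ≤ 6 * t := (by positivity); linarith) hr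
  -- closure: every point of a scope of `J` lies in a second scope of `J`
  have hcl : ∀ i ∈ J, ∀ w ∈ S i, ∃ i' ∈ J, i' ≠ i ∧ w ∈ S i' := by
    intro i hi w hw
    have hwc : w ∈ cover S J := subset_cover hi hw
    have hdeg : coverDegree S J w ≠ 1 := fun h1 => by
      have : w ∈ boundary S J := mem_boundary.2 ⟨hwc, h1⟩
      simp [hbd] at this
    have h1 : 1 ≤ coverDegree S J w := one_le_coverDegree hwc
    have h2 : 1 < (J.filter fun i' => w ∈ S i').card := by unfold coverDegree at hdeg h1; omega
    obtain ⟨i', hi', hne⟩ := Finset.exists_mem_ne h2 i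
    rw [Finset.mem_filter] at hi'
    exact ⟨i', hi'.1, hne, hi'.2⟩
  obtain ⟨i, hi⟩ := hJ
  have hSi : 0 < (S i).card := hexp.card_pos hc hr1 i
  obtain ⟨w, hw⟩ := Finset.card_pos.1 hSi
  obtain ⟨i', hi', hne, hw'⟩ := hcl i hi w hw
  -- `t ≥ 1`, so `r ≥ 7 ≥ 2`
  have ht1 : 1 ≤ t := by
    by_contra h0
    have : t = 0 := by omega
    rw [this, pow_zero] at ht
    have : w ∈ cover S J := subset_cover hi hw
    rw [Finset.card_eq_zero.1 (by omega : (cover S J).card = 0)] at this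
    simp at this
  have hr2 : (2 : ℝ) ≤ r :=
    le_trans (by have h1t : (1 : ℝ) ≤ t := (by exact_mod_cast ht1); linarith) hr
  by_cases hℓ4 : ℓ ≤ 3
  · -- two scopes through a common point violate expansion
    have hpair := hexp {i, i'} (by rw [Finset.card_pair hne.symm]; exact_mod_cast hr2)
    have hcov : cover S {i, i'} = S i ∪ S i' := by simp [cover]
    have hwbd : w ∉ boundary S {i, i'} := by
      intro hwb
      obtain ⟨k, -, huniq⟩ := existsUnique_of_mem_boundary hwb
      have e1 := huniq i ⟨by simp, hw⟩
      have e2 := huniq i' ⟨by simp, hw'⟩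
      exact hne (e2.trans e1.symm)
    have hsub : boundary S {i, i'} ⊆ (S i ∪ S i').erase w := by
      intro x hx
      rw [Finset.mem_erase]
      refine ⟨fun h => hwbd (h ▸ hx), ?_⟩
      rw [← hcov]; exact boundary_subset_cover _ hx
    have hcardU : (S i ∪ S i').card + 1 ≤ (S i).card + (S i').card := by
      have h1 := Finset.card_union_add_card_inter (S i) (S i')
      have h2 : 1 ≤ (S i ∩ S i').card := Finset.card_pos.2 ⟨w, Finset.mem_inter.2 ⟨hw, hw'⟩⟩
      omega
    have hbcard : (boundary S {i, i'}).card + 2 ≤ 2 * ℓ := by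
      have h1 := Finset.card_le_card hsub
      rw [Finset.card_erase_of_mem (Finset.mem_union_left _ hw)] at h1
      have := hS i; have := hS i'
      have hpos : 0 < (S i ∪ S i').card := Finset.card_pos.2 ⟨w, Finset.mem_union_left _ hw⟩
      omega
    have hbreal : ((boundary S {i, i'}).card : ℝ) + 2 ≤ 2 * ℓ := by exact_mod_cast hbcard
    rw [Finset.card_pair hne.symm] at hpair
    have hℓ3 : (ℓ : ℝ) ≤ 3 := by exact_mod_cast hℓ4
    push_cast at hpair
    linarith
  · -- `4 ≤ ℓ ≤ 8`: three lassos
    have h3 : ∀ k ∈ J, 3 ≤ (S k).card := by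
      intro k _
      have h1 := hexp {k} (by simpa using hr1)
      have h2 : (boundary S {k}).card ≤ (S k).card :=
        (Finset.card_le_card (boundary_subset_cover _)).trans (by simp [cover])
      have h2' : ((boundary S {k}).card : ℝ) ≤ (S k).card := by exact_mod_cast h2
      have hℓ4' : (4 : ℝ) ≤ ℓ := by exact_mod_cast (by omega : 4 ≤ ℓ)
      simp only [Finset.card_singleton, Nat.cast_one, mul_one] at h1
      have : (3 : ℝ) ≤ (S k).card := by linarith
      exact_mod_cast this
    obtain ⟨F, hFcard, hF⟩ :=
      exists_overShared_of_boundary_eq_empty (S := S) ⟨i, hi⟩ hcl h3 ht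
    have hFr : (F.card : ℝ) ≤ r := le_trans (by exact_mod_cast hFcard) hr
    have hup := sum_coverDegree_two_le_of_isBoundaryExpander hS hexp hFr
    have hlow : (2 * F.card + 1 : ℝ) ≤ ((∑ w ∈ (cover S F).filter
        (fun w => 2 ≤ coverDegree S F w), coverDegree S F w : ℕ) : ℝ) := by exact_mod_cast hF
    have hℓ8' : (ℓ : ℝ) ≤ 8 := by exact_mod_cast hℓ8
    have hF0 : (0 : ℝ) ≤ F.card := Nat.cast_nonneg _
    nlinarith

end Scopes

/-! ### Expanding `ℓ`-sparse systems over `𝔽₂` with `ℓ ≤ 8` are solvable -/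

/-- **Expanding `ℓ`-sparse systems with `ℓ ≤ 8` and polynomially many variables are solvable.**
If the rows of a system over `𝔽₂` in `n < 2^t` variables have supports of size `≤ ℓ`,
`1 ≤ ℓ ≤ 8`, forming an `(r, 3/4 · ℓ)`-boundary expander with `r ≥ 6 t + 1`, then the whole system
has a solution: every nonempty row set has a boundary variable
(`boundary_nonempty_of_isBoundaryExpander_of_le_eight`, the cover of any row set lies in
`range n`), so the system peels (`exists_rows_hold_of_forall_boundary_nonempty`). [folklore] -/
theorem systemSat_of_isBoundaryExpander_of_le_eight {ℓ n m : ℕ} (E : Fin m → LinEqMod 2 n)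
    (hℓ1 : 1 ≤ ℓ) (hℓ8 : ℓ ≤ 8) (hsparse : ∀ i, (E i).supp.card ≤ ℓ) {r : ℝ} {t : ℕ}
    (ht : n < 2 ^ t) (hr : (6 * t + 1 : ℝ) ≤ r)
    (hexp : IsBoundaryExpander (fun i => (E i).supp.map Fin.valEmbedding) r (3 / 4 * ℓ)) :
    SystemSat E Finset.univ := by
  have hS : ∀ i, ((fun i => (E i).supp.map Fin.valEmbedding) i).card ≤ ℓ := fun i => by
    simpa using hsparse i
  have hbd : ∀ J ⊆ (Finset.univ : Finset (Fin m)), J.Nonempty →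
      (boundary (fun i => (E i).supp.map Fin.valEmbedding) J).Nonempty := by
    intro J _ hJ
    have hcov : (cover (fun i => (E i).supp.map Fin.valEmbedding) J).card ≤ n := by
      have hsub : cover (fun i => (E i).supp.map Fin.valEmbedding) J ⊆ Finset.range n := by
        intro x hx
        obtain ⟨i, -, hxi⟩ := mem_cover.1 hx
        obtain ⟨y, -, rfl⟩ := Finset.mem_map.1 hxi
        simp
      simpa using Finset.card_le_card hsub
    exact boundary_nonempty_of_isBoundaryExpander_of_le_eight hℓ1 hℓ8 hS (lt_of_le_of_lt hcov ht)
      hr hexp hJ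
  obtain ⟨σ, hσ⟩ := exists_rows_hold_of_forall_boundary_nonempty E Finset.univ hbd
  exact ⟨blockVals 2 1 n σ, fun i hi => hσ i hi⟩

/-! ### The `ℓ ≤ 8` slice of the item and the reduction to `ℓ ≥ 9`, `d ≥ 7` -/

/-- The logarithmic threshold: for `0 < p` there is `N` with `6 (⌊log₂ n⌋ + 1) + 1 ≤ n^p` for all
`n ≥ N` (via `⌊log₂ n⌋ log 2 ≤ log n ≤ n^{p/2} / (p/2)`). [folklore] -/
theorem exists_nat_log_threshold {p : ℝ} (hp : 0 < p) :
    ∃ N : ℕ, ∀ n : ℕ, N ≤ n → (6 * ((Nat.log 2 n + 1 : ℕ) : ℝ) + 1) ≤ (n : ℝ) ^ p := by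
  set ε : ℝ := p / 2 with hε
  have hεpos : 0 < ε := by positivity
  have hlog2 : 0 < Real.log 2 := Real.log_pos one_lt_two
  set A : ℝ := 6 / (ε * Real.log 2) + 7 with hA
  have hA0 : 0 ≤ A := by have h0 : 0 ≤ 6 / (ε * Real.log 2) := (by positivity); linarith
  refine ⟨max 1 ⌈A ^ (1 / ε)⌉₊, fun n hn => ?_⟩
  have hn1 : 1 ≤ n := le_trans (le_max_left _ _) hn
  have hnA : A ≤ (n : ℝ) ^ ε := le_rpow_of_ceil_le hA0 hεpos (le_trans (le_max_right _ _) hn)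
  have hn1' : (1 : ℝ) ≤ n := by exact_mod_cast hn1
  have hnpos : (0 : ℝ) < n := by linarith
  -- `⌊log₂ n⌋ · log 2 ≤ log n ≤ n^ε / ε`
  have hL : (Nat.log 2 n : ℝ) * Real.log 2 ≤ Real.log n := by
    have h1 : ((2 ^ Nat.log 2 n : ℕ) : ℝ) ≤ n := by
      exact_mod_cast Nat.pow_log_le_self 2 (by omega : n ≠ 0)
    push_cast at h1
    have h2 : Real.log ((2 : ℝ) ^ Nat.log 2 n) ≤ Real.log n := Real.log_le_log (by positivity) h1
    rwa [Real.log_pow] at h2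
  have hlogn : Real.log n ≤ (n : ℝ) ^ ε / ε := Real.log_le_rpow_div hnpos.le hεpos
  have hLle : (Nat.log 2 n : ℝ) ≤ (n : ℝ) ^ ε / (ε * Real.log 2) := by
    rw [le_div_iff₀ (by positivity)]
    calc (Nat.log 2 n : ℝ) * (ε * Real.log 2) = ε * ((Nat.log 2 n : ℝ) * Real.log 2) := by ring
      _ ≤ ε * Real.log n := by gcongr
      _ ≤ ε * ((n : ℝ) ^ ε / ε) := by gcongr
      _ = (n : ℝ) ^ ε := by field_simp
  have hone : (1 : ℝ) ≤ (n : ℝ) ^ ε := Real.one_le_rpow hn1' hεpos.le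
  have hrpow0 : (0 : ℝ) ≤ (n : ℝ) ^ ε := by positivity
  calc (6 * ((Nat.log 2 n + 1 : ℕ) : ℝ) + 1) = 6 * (Nat.log 2 n : ℝ) + 7 := by push_cast; ring
    _ ≤ 6 * ((n : ℝ) ^ ε / (ε * Real.log 2)) + 7 * (n : ℝ) ^ ε := by nlinarith
    _ = A * (n : ℝ) ^ ε := by rw [hA]; ring
    _ ≤ (n : ℝ) ^ ε * (n : ℝ) ^ ε := by gcongr
    _ = (n : ℝ) ^ p := by rw [← Real.rpow_add hnpos, hε]; ring_nf

/-- **The `ℓ ≤ 8` slice of `LinearGeneratorDepthFregeHard` holds** (vacuously: with the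
threshold `N` of `exists_nat_log_threshold` for `p = 1 - δ` and `t = ⌊log₂ n⌋ + 1`, every
`ℓ`-sparse `(n^{1-δ}, 3/4·ℓ)`-boundary-expanding system over `𝔽₂` in `n ≥ N` variables with
`ℓ ≤ 8` is solvable, by `systemSat_of_isBoundaryExpander_of_le_eight`). The statement is the route
decl `Summit.PneNP.PneNP.Theses.ExpanderLinearGenerators.LinearGeneratorDepthFregeHard` with the
extra hypothesis `ℓ ≤ 8`; at `ℓ = 8` this is specific to the item's polynomial regime
`r = n^{1-δ}` (the sibling rung `ExpansionForcesDepthFregeSize`, uniform in `n`, does have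
`ℓ = 8` instances: incidence structures of girth `> r` on `2^{Ω(r)}` points). [folklore] -/
theorem linearGeneratorDepthFregeHard_locality_le_eight :
    ∀ (ℓ d : ℕ) (δ : ℝ), 1 ≤ ℓ → 0 < δ → δ < 1 → ℓ ≤ 8 → ∃ ε : ℝ, 0 < ε ∧ ∃ N : ℕ, ∀ n : ℕ, N ≤ n →
      ∀ (m : ℕ) (E : Fin m → Literature.Computability.MetaComplexity.LinEqMod 2 n),
        (∀ i, (E i).supp.card ≤ ℓ) →
        Literature.Computability.MetaComplexity.IsBoundaryExpander
          (fun i => (E i).supp.map Fin.valEmbedding) ((n : ℝ) ^ (1 - δ)) (3 / 4 * ℓ) →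
        ¬ Literature.Computability.MetaComplexity.SystemSat E Finset.univ →
        ∀ π : List (Literature.Computability.Complexity.PropForm ℕ),
          Literature.Computability.MetaComplexity.textbookFrege.IsDepthProofOf d π
            (Literature.Computability.Complexity.PropForm.neg
              (Literature.Computability.Complexity.PropForm.ofCNF
                (Literature.Computability.MetaComplexity.sumEncoding 1 E))) →
          (2 : ℝ) ^ ((n : ℝ) ^ ε) ≤ (Literature.Computability.MetaComplexity.proofSize π : ℝ) := by
  intro ℓ d δ hℓ _hδ hδ1 hℓ8
  obtain ⟨N, hN⟩ := exists_nat_log_threshold (by linarith : 0 < 1 - δ)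
  refine ⟨1, one_pos, N, fun n hn m E hsparse hexp hunsat π _hπ => ?_⟩
  exact absurd (systemSat_of_isBoundaryExpander_of_le_eight E hℓ hℓ8 hsparse
    (Nat.lt_pow_succ_log_self one_lt_two n) (hN n hn) hexp) hunsat

open Summit.PneNP.PneNP.Theses.ExpanderLinearGenerators in
/-- **Reduction of the crux to locality `≥ 9` and depth `≥ 7`.** Item stmt-PneNP-11443
(`LinearGeneratorDepthFregeHard`, Krajíček's Problem 19.4.5 in universal-expander form) is
equivalent to its restriction to `ℓ ≥ 9` and `d ≥ 7`: the corners `ℓ ≤ 8`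
(`linearGeneratorDepthFregeHard_locality_le_eight`) and `d ≤ 6`
(`linearGeneratorDepthFregeHard_depth_le_six`) hold vacuously. From `ℓ = 9` on the hypotheses are
satisfiable in the item's regime (Tseitin systems of random `9`-regular graphs), so all of the
item's content — the AC⁰-Frege lower bound for expanding linear systems over `𝔽₂` — lives in
`ℓ ≥ 9`, `d ≥ 7`. [folklore] -/
theorem linearGeneratorDepthFregeHard_iff_nine_le_and_seven_le :
    LinearGeneratorDepthFregeHard ↔
    ∀ (ℓ d : ℕ) (δ : ℝ), 1 ≤ ℓ → 0 < δ → δ < 1 → 9 ≤ ℓ → 7 ≤ d →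
      ∃ ε : ℝ, 0 < ε ∧ ∃ N : ℕ, ∀ n : ℕ, N ≤ n →
      ∀ (m : ℕ) (E : Fin m → Literature.Computability.MetaComplexity.LinEqMod 2 n),
        (∀ i, (E i).supp.card ≤ ℓ) →
        Literature.Computability.MetaComplexity.IsBoundaryExpander
          (fun i => (E i).supp.map Fin.valEmbedding) ((n : ℝ) ^ (1 - δ)) (3 / 4 * ℓ) →
        ¬ Literature.Computability.MetaComplexity.SystemSat E Finset.univ →
        ∀ π : List (Literature.Computability.Complexity.PropForm ℕ),
          Literature.Computability.MetaComplexity.textbookFrege.IsDepthProofOf d π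
            (Literature.Computability.Complexity.PropForm.neg
              (Literature.Computability.Complexity.PropForm.ofCNF
                (Literature.Computability.MetaComplexity.sumEncoding 1 E))) →
          (2 : ℝ) ^ ((n : ℝ) ^ ε) ≤ (Literature.Computability.MetaComplexity.proofSize π : ℝ) := by
  refine ⟨fun h ℓ d δ hℓ hδ hδ1 _ _ => h ℓ d δ hℓ hδ hδ1, fun h ℓ d δ hℓ hδ hδ1 => ?_⟩
  by_cases hℓ9 : 9 ≤ ℓ
  · by_cases hd : 7 ≤ d
    · exact h ℓ d δ hℓ hδ hδ1 hℓ9 hd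
    · exact linearGeneratorDepthFregeHard_depth_le_six ℓ d δ hℓ hδ hδ1 (by omega)
  · exact linearGeneratorDepthFregeHard_locality_le_eight ℓ d δ hℓ hδ hδ1 (by omega)

end Summit.PneNP.PneNP.Theorems
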